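import Summits.QuantumFields.QCD.Theorems.QuarksAsStableActionStableActionBridgeTransferPositivity

/-!
# The vacuum Rayleigh quotient of the QCD transfer operator is strictly positive
(crux `QuarksAsStableAction.StableActionBridge`, item stmt-QuantumFields-9737, line `Sketch`;
registered stub `transferRayleigh_vacuum_pos` of the lead skeleton)

`Literature/MathematicalPhysics/QuantumFieldTheory/QCDTransferMatrix.lean` renders Lüscher's transfer operator of
lattice QCD with `r = 1` Wilson quarks through the weighted pairing
`𝔫(Φ, Ψ) = ∫ ⟨Φ(U), T̂_F(U) Ψ(U)⟩ dU` (`fermionWeightForm`), the transfer form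
`𝔱(Φ, Ψ) = ∫∫ K_β(U, U') ⟨T̂_F(U) Φ(U), T̂_F(U') Ψ(U')⟩ dU dU'` (`transferForm`) and the Rayleigh quotient
`R(Ψ) = Re 𝔱(Ψ,Ψ) / Re 𝔫(Ψ,Ψ)` (`transferRayleigh`), whose unconstrained supremum over the form core is the vacuum
level `λ₀ = qcdTransferLevel … 0`.  Since the constant vacuum wave function `Ω : U ↦ |0⟩` lies in the core,
`λ₀ ≥ R(Ω)`, and this file proves `R(Ω) > 0` for every `β` and all bare masses `m_f > −1`:

* `T̂_F(U) Ω = a(U) Ω` with the Dirac-sea factor `a(U) = (det A(U))²` (`Γ(M)|0⟩ = |0⟩`, `fockLift_mulVec_vacuum`),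
  and `a(U)` is a positive real because `A(U) = sliceMassHop U mq` is Hermitian positive definite
  (`sliceMassHop_posDef`); `⟨0|0⟩ = 1`;
* hence `𝔫(Ω, Ω) = ∫ a(U) dU` and `𝔱(Ω, Ω) = ∫∫ K_β(U, U') a(U) a(U') dU dU'` are integrals of CONTINUOUS, everywhere
  strictly positive real functions (`continuous_sliceMassHop_det`, `continuous_gaugeSliceKernel`, `gaugeSliceKernel_pos`)
  over the probability measure `sliceHaar` (resp. its square) on the compact configuration space, so both real parts
  are `> 0` (`fermionWeightForm_vacuum_re_pos`, `transferForm_vacuum_re_pos`; the integrands are bounded, hence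
  integrable, and their supports are everything; the iterated integral is handled by Fubini,
  `Integrable.integral_prod_left`);
* `R(Ω) = Re 𝔱(Ω,Ω) / Re 𝔫(Ω,Ω) > 0` (`transferRayleigh_vacuum_pos`).

References: M. Lüscher, Commun. Math. Phys. 54 (1977) 283 [Luscher1977, pp. 283–292]; J. Smit, *Introduction to Quantum
Fields on a Lattice*, §6.5 (6.87)–(6.91) [Smit2023]; M. Reed, B. Simon, *Methods of Modern Mathematical Physics IV*,
Thm XIII.1 [ReedSimonIV1978].
-/

noncomputable section

namespace Summit.QuantumFields.QCD.Cruxes.StableActionBridge.Sketch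

open scoped ComplexOrder
open MeasureTheory Matrix Literature.MathematicalPhysics.QuantumFieldTheory Literature.MathematicalPhysics.QuantumLattice

namespace TransferVacuumRayleigh

variable {Nf S : ℕ} [NeZero S]

/-- For `m_f > −1` the Dirac-sea factor `a(U) = (det A(U))²` is a positive real number: `0 < Re a(U)` and
`Im a(U) = 0` (`A(U) = sliceMassHop U mq` is Hermitian positive definite, so `det A(U) > 0`). [folklore] -/
theorem det_sq_re_pos_and_im_eq_zero (U : GaugeConfig 3 S (Matrix.specialUnitaryGroup (Fin 3) ℂ))
    (mq : Fin Nf → ℝ) (hm : ∀ f, -1 < mq f) :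
    0 < ((sliceMassHop U mq).det ^ 2).re ∧ ((sliceMassHop U mq).det ^ 2).im = 0 := by
  have h : (0 : ℂ) < (sliceMassHop U mq).det ^ 2 :=
    pow_pos (sliceMassHop_posDef Nf S U mq hm).det_pos 2
  rw [Complex.pos_iff] at h
  exact ⟨h.1, h.2.symm⟩

/-- The Dirac-sea factor is the complexification of its real part (for `m_f > −1`). [folklore] -/
theorem ofReal_det_sq_re (U : GaugeConfig 3 S (Matrix.specialUnitaryGroup (Fin 3) ℂ))
    (mq : Fin Nf → ℝ) (hm : ∀ f, -1 < mq f) :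
    ((((sliceMassHop U mq).det ^ 2).re : ℝ) : ℂ) = (sliceMassHop U mq).det ^ 2 :=
  Complex.ext (Complex.ofReal_re _)
    (by rw [Complex.ofReal_im, (det_sq_re_pos_and_im_eq_zero U mq hm).2])

/-- The real Dirac-sea factor `U ↦ Re (det A(U))²` is continuous in the background. [folklore] -/
theorem continuous_det_sq_re (mq : Fin Nf → ℝ) :
    Continuous fun U : GaugeConfig 3 S (Matrix.specialUnitaryGroup (Fin 3) ℂ) =>
      ((sliceMassHop (Nf := Nf) U mq).det ^ 2).re :=
  Complex.continuous_re.comp ((FermionSliceContinuous.continuous_sliceMassHop_det mq).pow 2)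

/-- `T̂_F(U)` acts on the Fock vacuum by the Dirac-sea factor: `T̂_F(U)|0⟩ = (det A(U))² |0⟩`
(`Γ(M)|0⟩ = |0⟩`). [cite: Smit2023, §6.5 (6.91)] -/
theorem fermionSliceOp_mulVec_vacuum (U : GaugeConfig 3 S (Matrix.specialUnitaryGroup (Fin 3) ℂ))
    (mq : Fin Nf → ℝ) :
    fermionSliceOp U mq *ᵥ (vacuum : Fock (SliceFermiIdx Nf S)) =
      ((sliceMassHop U mq).det ^ 2) • (vacuum : Fock (SliceFermiIdx Nf S)) := by
  unfold fermionSliceOp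
  rw [Matrix.smul_mulVec, fockLift_mulVec_vacuum]

/-- Fock pairing of two multiples of the vacuum: `⟨x|0⟩, y|0⟩⟩ = conj x · y` (`⟨0|0⟩ = 1`). [folklore] -/
theorem star_smul_vacuum_dotProduct (x y : ℂ) :
    star (x • (vacuum : Fock (SliceFermiIdx Nf S))) ⬝ᵥ (y • (vacuum : Fock (SliceFermiIdx Nf S))) =
      star x * y := by
  simp [vacuum, dotProduct, Pi.single_apply, Finset.sum_ite_eq', apply_ite star]

/-- The transfer-form integrand on the vacuum is the real, strictly positive function
`K_β(U, U') · Re a(U) · Re a(U')` (as a complex number). [folklore] -/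
theorem transferForm_vacuum_integrand (β : ℝ) (mq : Fin Nf → ℝ) (hm : ∀ f, -1 < mq f)
    (U U' : GaugeConfig 3 S (Matrix.specialUnitaryGroup (Fin 3) ℂ)) :
    (gaugeSliceKernel β U U' : ℂ) *
        (star (fermionSliceOp U mq *ᵥ (vacuum : Fock (SliceFermiIdx Nf S))) ⬝ᵥ
          (fermionSliceOp U' mq *ᵥ (vacuum : Fock (SliceFermiIdx Nf S)))) =
      ((gaugeSliceKernel β U U' *
          (((sliceMassHop (Nf := Nf) U mq).det ^ 2).re * ((sliceMassHop (Nf := Nf) U' mq).det ^ 2).re) : ℝ) : ℂ) := by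
  rw [fermionSliceOp_mulVec_vacuum, fermionSliceOp_mulVec_vacuum, star_smul_vacuum_dotProduct,
    Complex.star_def, Complex.conj_eq_iff_im.2 (det_sq_re_pos_and_im_eq_zero U mq hm).2,
    Complex.ofReal_mul, Complex.ofReal_mul, ofReal_det_sq_re U mq hm, ofReal_det_sq_re U' mq hm]

/-- **The vacuum transfer form is a real double integral**:
`𝔱(Ω, Ω) = ∫∫ K_β(U, U') Re a(U) Re a(U') dU dU'` (as a complex number). [cite: Smit2023, §6.5 (6.87)–(6.91)] -/
theorem transferForm_vacuum_eq (β : ℝ) (mq : Fin Nf → ℝ) (hm : ∀ f, -1 < mq f) :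
    transferForm β mq (fun _ : GaugeConfig 3 S (Matrix.specialUnitaryGroup (Fin 3) ℂ) =>
        (vacuum : Fock (SliceFermiIdx Nf S)))
      (fun _ => vacuum) =
      ((∫ U, ∫ U', gaugeSliceKernel β U U' *
          (((sliceMassHop (Nf := Nf) U mq).det ^ 2).re * ((sliceMassHop (Nf := Nf) U' mq).det ^ 2).re)
          ∂(sliceHaar S) ∂(sliceHaar S) : ℝ) : ℂ) := by
  unfold transferForm
  simp_rw [transferForm_vacuum_integrand β mq hm, integral_complex_ofReal]

/-- **The vacuum weighted pairing is a real integral**: `𝔫(Ω, Ω) = ∫ Re a(U) dU` (as a complex number).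
[cite: Smit2023, §6.5 (6.91)] -/
theorem fermionWeightForm_vacuum_eq (mq : Fin Nf → ℝ) (hm : ∀ f, -1 < mq f) :
    fermionWeightForm mq (fun _ : GaugeConfig 3 S (Matrix.specialUnitaryGroup (Fin 3) ℂ) =>
        (vacuum : Fock (SliceFermiIdx Nf S))) (fun _ => vacuum) =
      ((∫ U, ((sliceMassHop (Nf := Nf) U mq).det ^ 2).re ∂(sliceHaar S) : ℝ) : ℂ) := by
  rw [fermionWeightForm_vacuum]
  simp_rw [← integral_complex_ofReal, ofReal_det_sq_re _ mq hm]

/-- A continuous, everywhere strictly positive real function on the slice configuration space has strictly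
positive Haar integral (it is bounded, hence integrable, on the probability space `sliceHaar`, and its support
is everything). [folklore] -/
theorem integral_sliceHaar_pos {f : GaugeConfig 3 S (Matrix.specialUnitaryGroup (Fin 3) ℂ) → ℝ}
    (hf : Continuous f) (hpos : ∀ U, 0 < f U) : 0 < ∫ U, f U ∂(sliceHaar S) := by
  haveI := isProbabilityMeasure_sliceHaar S
  obtain ⟨C, hC⟩ := exists_bound_of_continuous_slice hf
  have hint : Integrable f (sliceHaar S) :=
    Integrable.of_bound hf.measurable.aestronglyMeasurable C (Filter.Eventually.of_forall hC)
  rw [integral_pos_iff_support_of_nonneg (fun U => (hpos U).le) hint,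
    Set.eq_univ_of_forall fun U => Function.mem_support.2 (hpos U).ne', measure_univ]
  exact one_pos

/-- **Fubini input**: for a jointly continuous real integrand `F` on the (compact) product of two slice
configuration spaces, the inner Haar integral `U ↦ ∫ F(U, U') dU'` is Haar integrable (`F` is bounded and Borel,
hence integrable on the product probability space; `Integrable.integral_prod_left`). [folklore] -/
theorem integrable_inner_integral_sliceHaar
    {F : GaugeConfig 3 S (Matrix.specialUnitaryGroup (Fin 3) ℂ) ×
      GaugeConfig 3 S (Matrix.specialUnitaryGroup (Fin 3) ℂ) → ℝ} (hF : Continuous F) :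
    Integrable (fun U => ∫ U', F (U, U') ∂(sliceHaar S)) (sliceHaar S) := by
  haveI := isProbabilityMeasure_sliceHaar S
  obtain ⟨C, hC⟩ := isCompact_univ.exists_bound_of_continuousOn hF.continuousOn
  have hI : Integrable F ((sliceHaar S).prod (sliceHaar S)) :=
    Integrable.of_bound hF.measurable.aestronglyMeasurable C
      (Filter.Eventually.of_forall fun p => hC p (Set.mem_univ p))
  exact hI.integral_prod_left

/-- A jointly continuous, everywhere strictly positive real integrand has strictly positive iterated Haar
integral `∫ (∫ F(U, U') dU') dU > 0`. [folklore] -/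
theorem double_integral_sliceHaar_pos
    {F : GaugeConfig 3 S (Matrix.specialUnitaryGroup (Fin 3) ℂ) ×
      GaugeConfig 3 S (Matrix.specialUnitaryGroup (Fin 3) ℂ) → ℝ} (hF : Continuous F) (hpos : ∀ p, 0 < F p) :
    0 < ∫ U, ∫ U', F (U, U') ∂(sliceHaar S) ∂(sliceHaar S) := by
  haveI := isProbabilityMeasure_sliceHaar S
  have hinner : ∀ U, 0 < ∫ U', F (U, U') ∂(sliceHaar S) := fun U =>
    integral_sliceHaar_pos (hF.comp (Continuous.prodMk_right U)) fun U' => hpos (U, U')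
  rw [integral_pos_iff_support_of_nonneg (fun U => (hinner U).le) (integrable_inner_integral_sliceHaar hF),
    Set.eq_univ_of_forall fun U => Function.mem_support.2 (hinner U).ne', measure_univ]
  exact one_pos

end TransferVacuumRayleigh

open TransferVacuumRayleigh

/-- **The vacuum weighted pairing is strictly positive**: for all `m_f > −1`,
`Re 𝔫(Ω, Ω) = ∫ (det A(U))² dU > 0` for the constant vacuum wave function `Ω : U ↦ |0⟩` — the integrand is a
continuous, everywhere strictly positive real function of the background (`A(U) > 0`). In particular
`𝔫(Ω, Ω) ≠ 0`, so `Ω` is an admissible trial function for the vacuum level. [cite: Luscher1977, pp. 283–292]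
[cite: Smit2023, §6.5 (6.91)] -/
theorem fermionWeightForm_vacuum_re_pos (Nf S : ℕ) [NeZero S] (mq : Fin Nf → ℝ) (hm : ∀ f, -1 < mq f) :
    0 < (fermionWeightForm mq (fun _ : GaugeConfig 3 S (Matrix.specialUnitaryGroup (Fin 3) ℂ) =>
      (vacuum : Fock (SliceFermiIdx Nf S))) (fun _ => vacuum)).re := by
  rw [fermionWeightForm_vacuum_eq mq hm, Complex.ofReal_re]
  exact integral_sliceHaar_pos (continuous_det_sq_re mq) fun U => (det_sq_re_pos_and_im_eq_zero U mq hm).1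

/-- **The vacuum transfer form is strictly positive**: for every `β` and all `m_f > −1`,
`Re 𝔱(Ω, Ω) = ∫∫ K_β(U, U') (det A(U))² (det A(U'))² dU dU' > 0` — the integrand is jointly continuous and
everywhere strictly positive (`K_β > 0`, `A > 0`) on the compact product of the two slices.
[cite: Luscher1977, pp. 283–292] [cite: Smit2023, §6.5 (6.87)–(6.91)] -/
theorem transferForm_vacuum_re_pos (Nf S : ℕ) [NeZero S] (β : ℝ) (mq : Fin Nf → ℝ) (hm : ∀ f, -1 < mq f) :
    0 < (transferForm β mq (fun _ : GaugeConfig 3 S (Matrix.specialUnitaryGroup (Fin 3) ℂ) =>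
      (vacuum : Fock (SliceFermiIdx Nf S))) (fun _ => vacuum)).re := by
  rw [transferForm_vacuum_eq β mq hm, Complex.ofReal_re]
  have hr := continuous_det_sq_re (Nf := Nf) (S := S) mq
  exact double_integral_sliceHaar_pos
    ((continuous_gaugeSliceKernel S β).mul ((hr.comp continuous_fst).mul (hr.comp continuous_snd)))
    fun p => mul_pos (gaugeSliceKernel_pos β p.1 p.2)
      (mul_pos (det_sq_re_pos_and_im_eq_zero p.1 mq hm).1 (det_sq_re_pos_and_im_eq_zero p.2 mq hm).1)

/-- **The vacuum Rayleigh quotient of the QCD transfer operator is strictly positive** (registered stub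
`transferRayleigh_vacuum_pos` of line `Sketch`): for every `β` and all bare masses `m_f > −1`,
`R(Ω) = Re 𝔱(Ω,Ω) / Re 𝔫(Ω,Ω) > 0` for the constant vacuum wave function `Ω : U ↦ |0⟩`
(`T̂_F(U)Ω = (det A(U))² Ω`, `K_β > 0`, `A(U) > 0`: numerator and denominator are integrals of continuous strictly
positive functions). With `Ω ∈ transferCore` and `λ₀ = sup R` this gives `λ₀ > 0`.
[cite: Luscher1977, pp. 283–292] [cite: Smit2023, §6.5 (6.87)–(6.91)] [cite: ReedSimonIV1978, Thm XIII.1] -/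
theorem transferRayleigh_vacuum_pos : ∀ (Nf S : ℕ) [NeZero S] (β : ℝ) (mq : Fin Nf → ℝ), (∀ f, -1 < mq f) → 0 < transferRayleigh β mq (fun _ : GaugeConfig 3 S (Matrix.specialUnitaryGroup (Fin 3) ℂ) => (vacuum : Fock (SliceFermiIdx Nf S))) := by
  intro Nf S _ β mq hm
  unfold transferRayleigh
  exact div_pos (transferForm_vacuum_re_pos Nf S β mq hm) (fermionWeightForm_vacuum_re_pos Nf S mq hm)

end Summit.QuantumFields.QCD.Cruxes.StableActionBridge.Sketch

end
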